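import Summits.KontsevichZagierPeriods.Zeta5Search.Barrier.ConeGammaTorus

/-!
# ζ(5) search — BARRIER: local conicity of the torus saving (`S-E` structure, Lemma A) and the translate integral

HONEST FRAMING (cell `pub-zeta5`): systematic search; no irrationality claim unless kernel-certified. MODEL objects
under Brown–Zudilin's (28)+(30) accounting ([BZ22] = arXiv:2210.03391); nothing here is a statement about `ζ(5)`;
records in print UNMOVED. Infrastructure for `BARRIER-PLAN.md` §2b item (P4) (theory seat cert-2 g17, WAKE w3 of
lead/lit g23; source: P2 g11's structure memo `SE-STRUCTURE.md` §2, Lemma A «germ exactness» and the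
translate-average `G_{t₀}(δ)` of the lead's S-E″). The conjectured lemma S-E itself is NOT stated or filed.

* **`torusN_add_smul_of_germ`** (Lemma A, kernel form = LOCAL CONICITY): at a point `θ` and for a displacement
  `δ` such that, for every pair form, EITHER the form of `θ` is an integer and `|form(δ)| < 1` (a «member» wall)
  OR `|form(δ)|` is smaller than the distance of `form(θ)` to `ℤ` (a «non-member»), the saving is constant along the
  segment: `𝒩(θ + ε·δ) = 𝒩(θ + δ)` for all `0 < ε ≤ 1` — i.e. `𝒩` is positively homogeneous of degree `0` in
  `δ` near every point (this is exactly what makes the cusp coefficients `K_b`, `S(t₀;v)` of §2b well defined and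
  degree-1 homogeneous); `floor_add_mul_eq_of_member`, `floor_add_mul_eq_of_nonmember` are the two scalar cases.
* `translateIntegral a T δ := ∫₀^T 𝒩(u·s(a) + δ) du` (P2's `P(s)`, the lead's `λ₀·G_{t₀}(δ)`), with
  `intervalIntegrable_torusN_line` (the integrand is measurable and bounded by `7`) and
  **`translateIntegral_add_smul_sParam`**: `P(δ + c·s(a)) = P(δ)` for a period `T` of the orbit — only the
  transversal part `v(δ)` of the shift matters (S-E″ remark).
Not here (honest): Lemma B (exact first-order identity `P(εδ) − P(0) = ε·ΣK_b(δ)` below an explicit radius) —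
it needs the cluster decomposition of one period (breakpoint gaps `g_min`, wall distances `d_min`); its two
ingredients ARE here (local conicity) and in `ConeGammaBreakpoints` (the sorted breakpoints of a period).
-/

noncomputable section

open Set MeasureTheory
open scoped Topology

namespace Summit.KontsevichZagierPeriods.Zeta5Search.Barrier.ConeGamma

/-! ### Lemma A: local conicity -/

/-- Member wall: `x ∈ ℤ`, `|y| < 1`, `0 < ε ≤ 1` ⇒ `⌊x + εy⌋ = ⌊x + y⌋` (`= x` if `y ≥ 0`, `= x − 1` if `y < 0`). -/
theorem floor_add_mul_eq_of_member {x y ε : ℝ} (hx : ∃ z : ℤ, x = z) (hy : |y| < 1) (hε0 : 0 < ε) (hε1 : ε ≤ 1) :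
    ⌊x + ε * y⌋ = ⌊x + y⌋ := by
  obtain ⟨z, rfl⟩ := hx
  rw [add_comm, Int.floor_add_intCast, add_comm (z : ℝ), Int.floor_add_intCast]
  congr 1
  rcases le_or_gt 0 y with h | h
  · have h1 : y < 1 := (abs_lt.mp hy).2
    rw [Int.floor_eq_zero_iff.mpr ⟨by positivity, by nlinarith⟩, Int.floor_eq_zero_iff.mpr ⟨h, h1⟩]
  · have h1 : -1 < y := (abs_lt.mp hy).1
    have e1 : ⌊ε * y⌋ = -1 := by
      rw [Int.floor_eq_iff]; push_cast; constructor <;> nlinarith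
    have e2 : ⌊y⌋ = -1 := by
      rw [Int.floor_eq_iff]; push_cast; constructor <;> linarith
    rw [e1, e2]

/-- Non-member: `|y| < dist(x, ℤ)`, `0 ≤ ε ≤ 1` ⇒ `⌊x + εy⌋ = ⌊x⌋`. -/
theorem floor_add_mul_eq_of_nonmember {x y ε : ℝ} (hy : ∀ z : ℤ, |y| < |x - z|) (hε0 : 0 ≤ ε) (hε1 : ε ≤ 1) :
    ⌊x + ε * y⌋ = ⌊x⌋ := by
  have hlo := hy ⌊x⌋
  have hhi := hy (⌊x⌋ + 1)
  have h1 : 0 ≤ x - ⌊x⌋ := by linarith [Int.floor_le x]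
  have h2 : x - ((⌊x⌋ + 1 : ℤ) : ℝ) < 0 := by push_cast; linarith [Int.lt_floor_add_one x]
  rw [abs_of_nonneg h1] at hlo
  rw [abs_of_neg h2] at hhi
  push_cast at hhi
  have hεy : |ε * y| ≤ |y| := by
    rw [abs_mul, abs_of_nonneg hε0]
    exact mul_le_of_le_one_left (abs_nonneg y) hε1
  have h3 := neg_abs_le (ε * y)
  have h4 := le_abs_self (ε * y)
  rw [Int.floor_eq_iff]
  constructor <;> linarith

/-- **LEMMA A (local conicity of `𝒩`).** If at `θ`, for every pair form (`i ≠ j`), either `pairForm θ i j ∈ ℤ` and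
`|pairForm δ i j| < 1`, or `|pairForm δ i j| < |pairForm θ i j − z|` for every integer `z`, then
`𝒩(θ + ε·δ) = 𝒩(θ + δ)` for all `0 < ε ≤ 1`: the saving is constant along the segment, i.e. positively
homogeneous of degree `0` in the displacement (P2 g11, SE-STRUCTURE §2 Lemma A, «germ exactness»). -/
theorem torusN_add_smul_of_germ {θ δ : Fin 8 → ℝ}
    (h : ∀ i j : Fin 8, i ≠ j →
      ((∃ z : ℤ, pairForm θ i j = z) ∧ |pairForm δ i j| < 1) ∨ (∀ z : ℤ, |pairForm δ i j| < |pairForm θ i j - z|))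
    {ε : ℝ} (hε0 : 0 < ε) (hε1 : ε ≤ 1) : torusN (θ + ε • δ) = torusN (θ + δ) := by
  refine torusN_congr_floor fun i j hij => ?_
  rw [pairForm_add, pairForm_add, pairForm_smul]
  rcases h i j hij with ⟨hx, hy⟩ | hy
  · exact floor_add_mul_eq_of_member hx hy hε0 hε1
  · rw [floor_add_mul_eq_of_nonmember hy hε0.le hε1]
    have h1 := floor_add_mul_eq_of_nonmember hy zero_le_one le_rfl
    rw [one_mul] at h1
    rw [h1]

/-- The degenerate direction of Lemma A: with NO member walls the saving does not change at all,
`𝒩(θ + ε·δ) = 𝒩(θ)` for `0 ≤ ε ≤ 1`. -/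
theorem torusN_add_smul_of_nonmember {θ δ : Fin 8 → ℝ}
    (h : ∀ i j : Fin 8, i ≠ j → ∀ z : ℤ, |pairForm δ i j| < |pairForm θ i j - z|)
    {ε : ℝ} (hε0 : 0 ≤ ε) (hε1 : ε ≤ 1) : torusN (θ + ε • δ) = torusN θ := by
  refine torusN_congr_floor fun i j hij => ?_
  rw [pairForm_add, pairForm_smul]
  exact floor_add_mul_eq_of_nonmember (h i j hij) hε0 hε1

/-! ### The translate integral `P(δ) = ∫₀^T 𝒩(u·s(a) + δ) du` -/

/-- Along a line the forms are affine in `u`: `φ_k(u·s(a) + δ) = u·h_k(a) + φ_k(δ)`. -/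
theorem phiForm_line (a : Dir) (δ : Fin 8 → ℝ) (u : ℝ) (k : Fin 28) :
    phiForm (u • sParam a + δ) k = u * h28 a k + phiForm δ k := by
  rw [phiForm_add, phiForm_smul_sParam]

/-- Along a line, the permuted forms are affine in `u` as well. -/
theorem phiForm_permS_line (σ : Equiv.Perm (Fin 7)) (a : Dir) (δ : Fin 8 → ℝ) (u : ℝ) (k : Fin 28) :
    phiForm (permS σ (u • sParam a + δ)) k = u * h28 (permAct σ a) k + phiForm (permS σ δ) k := by
  rw [permS_add, phiForm_add, phiForm_permS_smul_sParam]

/-- `u ↦ torusTerm (u·s(a) + δ) σ` is measurable. -/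
theorem measurable_torusTerm_line (a : Dir) (δ : Fin 8 → ℝ) (σ : Equiv.Perm (Fin 7)) :
    Measurable fun u : ℝ => (torusTerm (u • sParam a + δ) σ : ℝ) := by
  have h : (fun u : ℝ => (torusTerm (u • sParam a + δ) σ : ℝ)) = fun u =>
      ∑ i ∈ FIdx, (((⌊u * h28 a i + phiForm δ i⌋ : ℤ) : ℝ) -
        ((⌊u * h28 (permAct σ a) i + phiForm (permS σ δ) i⌋ : ℤ) : ℝ)) := by
    funext u
    unfold torusTerm
    push_cast
    refine Finset.sum_congr rfl fun i _ => ?_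
    rw [phiForm_line, phiForm_permS_line]
  rw [h]
  refine Finset.measurable_sum _ fun i _ => ?_
  exact ((measurable_of_countable _).comp ((measurable_id.mul_const _).add_const _).floor).sub
    ((measurable_of_countable _).comp ((measurable_id.mul_const _).add_const _).floor)

/-- **`u ↦ 𝒩(u·s(a) + δ)` is measurable.** -/
theorem measurable_torusN_line (a : Dir) (δ : Fin 8 → ℝ) :
    Measurable fun u : ℝ => (torusN (u • sParam a + δ) : ℝ) := by
  have h : (fun u : ℝ => (torusN (u • sParam a + δ) : ℝ)) = (Finset.univ : Finset (Equiv.Perm (Fin 7))).sup'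
      Finset.univ_nonempty (fun σ => fun u : ℝ => (torusTerm (u • sParam a + δ) σ : ℝ)) := by
    funext u
    rw [Finset.sup'_apply]
    unfold torusN
    exact Finset.apply_sup'_eq_sup'_comp Finset.univ_nonempty (fun z : ℤ => (z : ℝ)) fun _ _ => Int.cast_max
  rw [h]
  exact Finset.measurable_sup' _ fun σ _ => measurable_torusTerm_line a δ σ

/-- `|𝒩| ≤ 7` as reals. -/
theorem abs_torusN_le_seven (θ : Fin 8 → ℝ) : |(torusN θ : ℝ)| ≤ 7 := by
  rw [abs_of_nonneg (by exact_mod_cast torusN_nonneg θ)]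
  exact_mod_cast torusN_le_seven θ

/-- **The translate integrand is integrable on every bounded interval.** -/
theorem intervalIntegrable_torusN_line (a : Dir) (δ : Fin 8 → ℝ) (α β : ℝ) :
    IntervalIntegrable (fun u : ℝ => (torusN (u • sParam a + δ) : ℝ)) volume α β := by
  refine IntervalIntegrable.mono_fun' (f := fun u => (torusN (u • sParam a + δ) : ℝ)) (g := fun _ => (7 : ℝ))
    intervalIntegrable_const (measurable_torusN_line a δ).aestronglyMeasurable ?_
  refine Filter.Eventually.of_forall fun u => ?_
  dsimp only
  rw [Real.norm_eq_abs]
  exact abs_torusN_le_seven _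

/-- **The translate integral** `P_{a,T}(δ) := ∫₀^T 𝒩(u·s(a) + δ) du` — the saving collected over one period of the
orbit translated by `δ` (P2 g11's `P(s)`; the lead's `G_{t₀}(δ) = P(δ)/λ₀`). -/
def translateIntegral (a : Dir) (T : ℝ) (δ : Fin 8 → ℝ) : ℝ :=
  ∫ u in (0 : ℝ)..T, (torusN (u • sParam a + δ) : ℝ)

/-- At `δ = 0` and for all-admissible `a` this is the period integral of `N_a`: `P(0) = ∫₀^T N_a(u) du`. -/
theorem translateIntegral_zero {a : Dir} (hadm : ∀ σ, Admissible a σ) (T : ℝ) :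
    translateIntegral a T 0 = ∫ u in (0 : ℝ)..T, (savingN a u : ℝ) := by
  unfold translateIntegral
  refine intervalIntegral.integral_congr fun u _ => ?_
  simp only [add_zero, savingN_eq_torusN hadm]

/-- The integrand is `T`-periodic in `u` when `T` is a period of the orbit. -/
theorem periodic_torusN_line {a : Dir} {T : ℝ} (hT : ∀ k : Fin 28, ∃ z : ℤ, T * h28 a k = z) (δ : Fin 8 → ℝ) :
    Function.Periodic (fun u : ℝ => (torusN (u • sParam a + δ) : ℝ)) T := by
  intro u
  simp only
  rw [add_smul, show u • sParam a + T • sParam a + δ = (u • sParam a + δ) + T • sParam a by abel,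
    torusN_add_of_pairInt]
  refine pairInt_of_phiForm_int fun k => ?_
  rw [phiForm_smul_sParam]
  exact hT k

/-- **Only the transversal part of the shift matters**: `P(δ + c·s(a)) = P(δ)` for every real `c`, when `T` is a
period of the orbit (translating along the orbit and using periodicity; the lead's remark that `G_{t₀}(δ)` depends
on `v(δ)_j = δ_j − δ₀ t_{0,j}` only). -/
theorem translateIntegral_add_smul_sParam {a : Dir} {T : ℝ} (hT : ∀ k : Fin 28, ∃ z : ℤ, T * h28 a k = z)
    (δ : Fin 8 → ℝ) (c : ℝ) : translateIntegral a T (δ + c • sParam a) = translateIntegral a T δ := by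
  unfold translateIntegral
  have hper := periodic_torusN_line hT δ
  have h1 : (fun u : ℝ => (torusN (u • sParam a + (δ + c • sParam a)) : ℝ)) =
      fun u => (torusN ((u + c) • sParam a + δ) : ℝ) := by
    funext u; congr 2; rw [add_smul]; abel
  rw [h1, intervalIntegral.integral_comp_add_right (fun u => (torusN (u • sParam a + δ) : ℝ)) c, zero_add]
  have h2 := hper.intervalIntegral_add_eq c 0
  rw [zero_add] at h2
  rw [add_comm T c]
  exact h2

end Summit.KontsevichZagierPeriods.Zeta5Search.Barrier.ConeGamma

end
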